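import Literature.NumberTheory.LFunctions.WeilZeroSum
import Literature.NumberTheory.LFunctions.MontgomeryZeroWindows
import Literature.NumberTheory.LFunctions.MontgomeryPairCorrelationProofs
import Literature.NumberTheory.LFunctions.ZetaZeroReciprocalSum
import HarnessLib

/-!
# The dictionary between the non-trivial zeros of `ζ` (with multiplicity) and the ordinates `γ_n`

Trunk T-ANT (`Literature/NumberTheory/LFunctions`). Proofs only (no definitions, no named facts).
Explicit formulas in the tree are sums over the zero SET with multiplicities
(`ρ : ZetaZeros.riemannZetaNontrivialZeros`, weight `m(ρ) = riemannZetaZeroOrder ρ`; e.g.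
`psiOne_eq_explicit`, the Guinand–Weil zero side `HasWeilZeroSide`, `WeilZeroSum.lean`), while the
pair correlation statements (`ZeroStatistics.lean`, `MontgomeryPairCorrelation.lean`) are written with
the ENUMERATION `γ_n = zetaOrdinate n` of the positive ordinates (0-indexed, non-decreasing, repeated
according to multiplicity) and its counting function `N(T) = zetaZeroCount T`. This file proves the
bookkeeping identity between the two (needed exactly once in the discharge of Montgomery's explicit
formula (P1) `montgomery_explicit_formula`, whose left side is `montgomeryZeroSum`):

* `OrdinateDictionary.card_filter_zetaOrdinate_eq` — for a height `y` of a zero with `0 < y ≤ T`: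
  `#{n < N(T) : γ_n = y} = ∑_{ρ in the box, Im ρ = y} m(ρ)` (both are `N(y) − N(y')`, `y'` the
  previous height; uses `γ_n ≤ T ↔ n < N(T)`, `MontgomeryZeroWindows.lean`, and
  `exists_zero_of_zetaOrdinate_holds`);
* `OrdinateDictionary.sum_zetaZeroBox_mul_eq_sum_range` — `∑_{ρ: 0<Im ρ≤T} m(ρ) g(Im ρ) = ∑_{n<N(T)} g(γ_n)`;
* `OrdinateDictionary.sum_weilZeroFinset_mul_eq_sum_range` — both signs:
  `∑_{|Im ρ| ≤ T} m(ρ) g(Im ρ) = ∑_{n<N(T)} (g(γ_n) + g(−γ_n))` (conjugate zeros have the same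
  multiplicity, `riemannZetaZeroOrder_conj_holds`);
* `tsum_nontrivialZeros_eq_tsum_zetaOrdinate` — the same for absolutely convergent sums
  (`N(T) → ∞`, `tendsto_zetaZeroCount_atTop_holds`; `weilZeroFinset T → atTop`, `tendsto_weilZeroFinset`);
* `tsum_zeroOrder_mul_cpow_div_eq_montgomeryZeroSum` — the case of Montgomery's weights:
  `∑_ρ m(ρ) x^{i Im ρ}/(1+(t−Im ρ)²) = montgomeryZeroSum x t` (unconditional; under RH the left side is
  the zero sum `∑_γ x^{iγ}/(1+(t−γ)²)` of Montgomery 1973, Lemma / Goldston 2005, (3.11)).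

## References

* E. C. Titchmarsh, *The Theory of the Riemann Zeta-Function*, 2nd ed. (1986), §9.1 (`N(T)`,
  ordinates), §2.12 (conjugate zeros).
* H. L. Montgomery, *The pair correlation of zeros of the zeta function*, Proc. Sympos. Pure Math. 24
  (1973), 181–193, Lemma.
-/

noncomputable section

open Complex Filter Set
open scoped Real Topology ComplexConjugate

namespace Literature.NumberTheory.LFunctions

namespace OrdinateDictionary

/-! ## Counting: `N(b) − N(a)` on both sides -/

/-- `N(T)` as the `Finset` sum of the multiplicities over the box of zeros `0 < Im ρ ≤ T`. [folklore] -/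
theorem natCast_zetaZeroCount_eq_sum (T : ℝ) :
    (zetaZeroCount T : ℤ) = ∑ ρ ∈ (zetaZeroBox_finite 0 T).toFinset, riemannZetaZeroOrder ρ := by
  rw [zetaZeroCount_eq_finsum, finsum_mem_eq_finite_toFinset_sum _ (zetaZeroBox_finite 0 T)]

/-- For `a ≤ b`: `N(b) − N(a) = ∑_{ρ in the box of height b, a < Im ρ} m(ρ)`. [folklore] -/
theorem natCast_zetaZeroCount_sub_eq_sum_filter {a b : ℝ} (hab : a ≤ b) :
    (zetaZeroCount b : ℤ) - zetaZeroCount a =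
      ∑ ρ ∈ (zetaZeroBox_finite 0 b).toFinset.filter (fun ρ ↦ a < ρ.im), riemannZetaZeroOrder ρ := by
  classical
  have ha : (zetaZeroBox_finite 0 a).toFinset =
      (zetaZeroBox_finite 0 b).toFinset.filter (fun ρ ↦ ¬ a < ρ.im) := by
    ext ρ
    simp only [Set.Finite.mem_toFinset, Finset.mem_filter, zetaZeroBox, Set.mem_setOf_eq, not_lt]
    constructor
    · rintro ⟨h0, h1, h2, h3, h4⟩; exact ⟨⟨h0, h1, h2, h3, h4.trans hab⟩, h4⟩
    · rintro ⟨⟨h0, h1, h2, h3, -⟩, h4⟩; exact ⟨h0, h1, h2, h3, h4⟩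
  rw [natCast_zetaZeroCount_eq_sum, natCast_zetaZeroCount_eq_sum, ha,
    ← Finset.sum_filter_add_sum_filter_not (zetaZeroBox_finite 0 b).toFinset (fun ρ ↦ a < ρ.im)]
  ring

/-- For `a ≤ b`: the indices `n < N(b)` with `a < γ_n` are exactly `N(a) ≤ n < N(b)`, so there are
`N(b) − N(a)` of them. [folklore] -/
theorem card_filter_lt_zetaOrdinate {a b : ℝ} (hab : a ≤ b) [DecidablePred fun n ↦ a < zetaOrdinate n] :
    (((Finset.range (zetaZeroCount b)).filter (fun n ↦ a < zetaOrdinate n)).card : ℤ) =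
      (zetaZeroCount b : ℤ) - zetaZeroCount a := by
  have h : (Finset.range (zetaZeroCount b)).filter (fun n ↦ a < zetaOrdinate n) =
      Finset.Ico (zetaZeroCount a) (zetaZeroCount b) := by
    ext n
    simp only [Finset.mem_filter, Finset.mem_range, Finset.mem_Ico, Montgomery.lt_zetaOrdinate_iff]
    tauto
  rw [h, Nat.card_Ico, Nat.cast_sub (zetaZeroCount_mono hab)]

/-! ## Every ordinate is the height of a zero in the box -/

/-- For `n < N(T)` there is a zero `ρ` of the box `0 < Im ρ ≤ T` with `Im ρ = γ_n`. [folklore] -/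
theorem exists_mem_zetaZeroBox_im_eq {n : ℕ} {T : ℝ} (hn : n < zetaZeroCount T) :
    ∃ ρ ∈ zetaZeroBox 0 T, ρ.im = zetaOrdinate n := by
  obtain ⟨σ, h0, h1, hζ⟩ := exists_zero_of_zetaOrdinate_holds n
  have hle : zetaOrdinate n ≤ T := Montgomery.zetaOrdinate_le_iff_lt.2 hn
  have hpos : 0 < zetaOrdinate n := zetaOrdinate_pos_holds n
  refine ⟨σ + zetaOrdinate n * I, ⟨hζ, ?_, ?_, ?_, ?_⟩, ?_⟩ <;> simp <;> linarith

/-! ## One height at a time -/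

/-- **The multiplicity of a height.** For a height `y` of a zero of the box `0 < Im ρ ≤ T`:
`#{n < N(T) : γ_n = y} = ∑_{ρ in the box, Im ρ = y} m(ρ)` (both equal `N(y) − N(y')` for the
previous height `y' < y`). [folklore] -/
theorem card_filter_zetaOrdinate_eq {T y : ℝ} (hy : y ∈ (zetaZeroBox_finite 0 T).toFinset.image Complex.im)
    [DecidablePred fun n ↦ zetaOrdinate n = y] :
    (((Finset.range (zetaZeroCount T)).filter (fun n ↦ zetaOrdinate n = y)).card : ℤ) =
      ∑ ρ ∈ (zetaZeroBox_finite 0 T).toFinset.filter (fun ρ ↦ ρ.im = y), riemannZetaZeroOrder ρ := by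
  classical
  set Z := (zetaZeroBox_finite 0 T).toFinset with hZ
  set H := Z.image Complex.im with hH
  -- `y` is a height: `0 < y ≤ T`
  obtain ⟨ρ₀, hρ₀, hρ₀y⟩ := Finset.mem_image.1 hy
  rw [hZ, Set.Finite.mem_toFinset] at hρ₀
  have hy0 : 0 < y := by rw [← hρ₀y]; exact hρ₀.2.2.2.1
  have hyT : y ≤ T := by rw [← hρ₀y]; exact hρ₀.2.2.2.2
  -- the previous height `y'`
  set H' : Finset ℝ := insert (y - 1) (H.filter (fun h ↦ h < y)) with hH'
  have hH'ne : H'.Nonempty := ⟨y - 1, Finset.mem_insert_self _ _⟩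
  set y' : ℝ := H'.max' hH'ne with hy'
  have hy'lt : y' < y := by
    have : ∀ h ∈ H', h < y := by
      intro h hh
      rw [hH', Finset.mem_insert, Finset.mem_filter] at hh
      rcases hh with rfl | ⟨-, hh⟩
      · linarith
      · exact hh
    exact this _ (Finset.max'_mem _ _)
  have hgap : ∀ h ∈ H, y' < h → h ≤ y → h = y := by
    intro h hh h1 h2
    by_contra hne
    have hlt : h < y := lt_of_le_of_ne h2 hne
    have hmem : h ∈ H' := by
      rw [hH', Finset.mem_insert, Finset.mem_filter]; exact Or.inr ⟨hh, hlt⟩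
    have := Finset.le_max' H' h hmem
    rw [← hy'] at this
    linarith
  -- heights of ordinates and of zeros up to `y` lie in `H`
  have hordH : ∀ n : ℕ, n < zetaZeroCount T → zetaOrdinate n ∈ H := by
    intro n hn
    obtain ⟨ρ, hρ, hρn⟩ := exists_mem_zetaZeroBox_im_eq hn
    rw [hH, Finset.mem_image]
    exact ⟨ρ, by rw [hZ, Set.Finite.mem_toFinset]; exact hρ, hρn⟩
  -- left-hand side: `{n < N(T) : γ_n = y} = {n < N(y) : y' < γ_n}`
  have hL : (Finset.range (zetaZeroCount T)).filter (fun n ↦ zetaOrdinate n = y) =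
      (Finset.range (zetaZeroCount y)).filter (fun n ↦ y' < zetaOrdinate n) := by
    ext n
    simp only [Finset.mem_filter, Finset.mem_range]
    constructor
    · rintro ⟨-, hn⟩
      refine ⟨Montgomery.zetaOrdinate_le_iff_lt.1 (by rw [hn]), by rw [hn]; exact hy'lt⟩
    · rintro ⟨hn, hn'⟩
      have hle : zetaOrdinate n ≤ y := Montgomery.zetaOrdinate_le_iff_lt.2 hn
      have hnT : n < zetaZeroCount T := lt_of_lt_of_le hn (zetaZeroCount_mono hyT)
      exact ⟨hnT, hgap _ (hordH n hnT) hn' hle⟩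
  -- right-hand side: `{ρ ∈ Z(T) : Im ρ = y} = {ρ ∈ Z(y) : y' < Im ρ}`
  have hR : Z.filter (fun ρ ↦ ρ.im = y) =
      (zetaZeroBox_finite 0 y).toFinset.filter (fun ρ ↦ y' < ρ.im) := by
    ext ρ
    simp only [hZ, Finset.mem_filter, Set.Finite.mem_toFinset, zetaZeroBox, Set.mem_setOf_eq]
    constructor
    · rintro ⟨⟨h0, h1, h2, h3, -⟩, h5⟩
      exact ⟨⟨h0, h1, h2, h3, h5.le⟩, by rw [h5]; exact hy'lt⟩
    · rintro ⟨⟨h0, h1, h2, h3, h4⟩, h5⟩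
      have hρT : ρ ∈ Z := by
        rw [hZ, Set.Finite.mem_toFinset]; exact ⟨h0, h1, h2, h3, h4.trans hyT⟩
      have hρH : ρ.im ∈ H := Finset.mem_image_of_mem _ hρT
      refine ⟨⟨h0, h1, h2, h3, h4.trans hyT⟩, hgap _ hρH h5 h4⟩
  rw [hL, hR, card_filter_lt_zetaOrdinate hy'lt.le, natCast_zetaZeroCount_sub_eq_sum_filter hy'lt.le]

/-! ## The finite dictionary -/

/-- **The finite dictionary** between the zeros of the box `0 < Im ρ ≤ T`, counted with
multiplicity, and the enumeration `γ_n`, `n < N(T)`: for every `g : ℝ → M`,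
`∑_{ρ in the box} m(ρ) • g(Im ρ) = ∑_{n < N(T)} g(γ_n)`. [folklore] -/
theorem sum_zetaZeroBox_eq_sum_range {M : Type*} [AddCommGroup M] [Module ℂ M] (g : ℝ → M) (T : ℝ) :
    ∑ ρ ∈ (zetaZeroBox_finite 0 T).toFinset, (riemannZetaZeroOrder ρ : ℂ) • g ρ.im =
      ∑ n ∈ Finset.range (zetaZeroCount T), g (zetaOrdinate n) := by
  classical
  set Z := (zetaZeroBox_finite 0 T).toFinset with hZ
  set H := Z.image Complex.im with hH
  have hordH : ∀ n ∈ Finset.range (zetaZeroCount T), zetaOrdinate n ∈ H := by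
    intro n hn
    obtain ⟨ρ, hρ, hρn⟩ := exists_mem_zetaZeroBox_im_eq (Finset.mem_range.1 hn)
    rw [hH, Finset.mem_image]
    exact ⟨ρ, by rw [hZ, Set.Finite.mem_toFinset]; exact hρ, hρn⟩
  rw [← Finset.sum_fiberwise_of_maps_to (fun ρ hρ ↦ Finset.mem_image_of_mem Complex.im hρ),
    ← Finset.sum_fiberwise_of_maps_to hordH]
  refine Finset.sum_congr rfl fun y hy ↦ ?_
  -- on each fibre both sides are `(count) • g y`
  have e1 : ∑ ρ ∈ Z.filter (fun ρ ↦ ρ.im = y), (riemannZetaZeroOrder ρ : ℂ) • g ρ.im =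
      ((∑ ρ ∈ Z.filter (fun ρ ↦ ρ.im = y), riemannZetaZeroOrder ρ : ℤ) : ℂ) • g y := by
    rw [Int.cast_sum, Finset.sum_smul]
    refine Finset.sum_congr rfl fun ρ hρ ↦ ?_
    rw [(Finset.mem_filter.1 hρ).2]
  have e2 : ∑ n ∈ (Finset.range (zetaZeroCount T)).filter (fun n ↦ zetaOrdinate n = y), g (zetaOrdinate n) =
      ((((Finset.range (zetaZeroCount T)).filter (fun n ↦ zetaOrdinate n = y)).card : ℤ) : ℂ) • g y := by
    rw [Finset.sum_congr rfl fun n hn ↦ by rw [(Finset.mem_filter.1 hn).2], Finset.sum_const,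
      ← Nat.cast_smul_eq_nsmul ℂ]
    norm_cast
  rw [e1, e2, card_filter_zetaOrdinate_eq hy]

/-- The finite dictionary for products: `∑_{ρ in the box} m(ρ) g(Im ρ) = ∑_{n < N(T)} g(γ_n)`
(`g : ℝ → ℂ`). [folklore] -/
theorem sum_zetaZeroBox_mul_eq_sum_range (g : ℝ → ℂ) (T : ℝ) :
    ∑ ρ ∈ (zetaZeroBox_finite 0 T).toFinset, (riemannZetaZeroOrder ρ : ℂ) * g ρ.im =
      ∑ n ∈ Finset.range (zetaZeroCount T), g (zetaOrdinate n) := by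
  have := sum_zetaZeroBox_eq_sum_range g T
  simpa only [smul_eq_mul] using this

/-! ## Both signs: the symmetric truncations of the zero side -/

/-- A `Finset` sum over `weilZeroFinset T` (inside the subtype of non-trivial zeros) is the sum
over the finite set `weilZeroIndex T ⊆ ℂ`. [folklore] -/
theorem sum_weilZeroFinset_eq (F : ℂ → ℂ) (T : ℝ) :
    ∑ ρ ∈ weilZeroFinset T, F ρ = ∑ z ∈ (weilZeroIndex_finite T).toFinset, F z := by
  classical
  have e : ∑ ρ ∈ weilZeroFinset T, F ρ =
      ∑ z ∈ (weilZeroFinset T).map (Function.Embedding.subtype _), F z := by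
    rw [Finset.sum_map]; rfl
  rw [e]
  refine Finset.sum_congr ?_ fun _ _ ↦ rfl
  ext z
  simp only [Set.Finite.mem_toFinset, Finset.mem_map, Function.Embedding.subtype_apply]
  constructor
  · rintro ⟨ρ, hρ, rfl⟩
    rw [weilZeroIndex_eq_inter]
    exact ⟨ρ.2, mem_weilZeroFinset.1 hρ⟩
  · intro hz
    have hz' : z ∈ ZetaZeros.riemannZetaNontrivialZeros := by
      rw [weilZeroIndex_eq_inter] at hz; exact hz.1
    refine ⟨⟨z, hz'⟩, ?_, rfl⟩
    rw [mem_weilZeroFinset]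
    rw [weilZeroIndex_eq_inter] at hz
    exact hz.2

/-- **The finite dictionary, both signs**: for `g : ℝ → ℂ`,
`∑_{ρ non-trivial, |Im ρ| ≤ T} m(ρ) g(Im ρ) = ∑_{n < N(T)} (g(γ_n) + g(−γ_n))` (the zeros with
`Im ρ < 0` are the conjugates of those with `Im ρ > 0`, with the same multiplicity,
`riemannZetaZeroOrder_conj_holds`). [folklore] -/
theorem sum_weilZeroFinset_mul_eq_sum_range (g : ℝ → ℂ) (T : ℝ) :
    ∑ ρ ∈ weilZeroFinset T, (riemannZetaZeroOrder (ρ : ℂ) : ℂ) * g (ρ : ℂ).im =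
      ∑ n ∈ Finset.range (zetaZeroCount T), (g (zetaOrdinate n) + g (-zetaOrdinate n)) := by
  classical
  rw [sum_weilZeroFinset_eq (fun z ↦ (riemannZetaZeroOrder z : ℂ) * g z.im)]
  have hW : (weilZeroIndex_finite T).toFinset =
      (zetaZeroBox_finite 0 T).toFinset ∪ (zetaZeroBox_finite 0 T).toFinset.image (starRingEnd ℂ) := by
    ext z
    simp only [Set.Finite.mem_toFinset, Finset.mem_union, Finset.mem_image, weilZeroIndex_eq_union,
      Set.mem_union, Set.mem_image]
  have hdisj : Disjoint (zetaZeroBox_finite 0 T).toFinset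
      ((zetaZeroBox_finite 0 T).toFinset.image (starRingEnd ℂ)) := by
    rw [Finset.disjoint_left]
    intro z hz hz'
    rw [Set.Finite.mem_toFinset] at hz
    obtain ⟨w, hw, rfl⟩ := Finset.mem_image.1 hz'
    rw [Set.Finite.mem_toFinset] at hw
    have h1 : 0 < (starRingEnd ℂ w).im := hz.2.2.2.1
    rw [Complex.conj_im] at h1
    linarith [hw.2.2.2.1]
  rw [hW, Finset.sum_union hdisj, Finset.sum_image fun a _ b _ h ↦ (starRingEnd ℂ).injective h,
    Finset.sum_add_distrib, sum_zetaZeroBox_mul_eq_sum_range g T,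
    ← sum_zetaZeroBox_mul_eq_sum_range (fun u ↦ g (-u)) T]
  congr 1
  refine Finset.sum_congr rfl fun ρ _ ↦ ?_
  rw [riemannZetaZeroOrder_conj_holds ρ, Complex.conj_im]

end OrdinateDictionary

/-! ## The dictionary for absolutely convergent sums -/

/-- **Sums over the non-trivial zeros versus sums over the ordinates.** If `g : ℝ → ℂ` gives an
(unconditionally) summable family `ρ ↦ m(ρ) g(Im ρ)` on the non-trivial zeros of `ζ` and
`n ↦ g(γ_n) + g(−γ_n)` is summable, then
`∑_ρ m(ρ) g(Im ρ) = ∑_n (g(γ_n) + g(−γ_n))`, where `γ_n = zetaOrdinate n` enumerates the positive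
ordinates with multiplicity (`ZetaZeros.lean`) and `m = riemannZetaZeroOrder`: the symmetric
truncations `|Im ρ| ≤ T` of the left side are the partial sums `n < N(T)` of the right side
(`OrdinateDictionary.sum_weilZeroFinset_mul_eq_sum_range`), and `N(T) → ∞`. This is the bridge
between explicit formulas written over the zero set (e.g. `psiOne_eq_explicit`) and the
ordinate bookkeeping of the pair correlation statements (`montgomeryZeroSum`). [folklore] -/
theorem tsum_nontrivialZeros_eq_tsum_zetaOrdinate (g : ℝ → ℂ)
    (hA : Summable fun ρ : ZetaZeros.riemannZetaNontrivialZeros ↦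
      (riemannZetaZeroOrder (ρ : ℂ) : ℂ) * g (ρ : ℂ).im)
    (hB : Summable fun n : ℕ ↦ g (zetaOrdinate n) + g (-zetaOrdinate n)) :
    ∑' ρ : ZetaZeros.riemannZetaNontrivialZeros, (riemannZetaZeroOrder (ρ : ℂ) : ℂ) * g (ρ : ℂ).im =
      ∑' n : ℕ, (g (zetaOrdinate n) + g (-zetaOrdinate n)) := by
  have h1 : Tendsto (fun T : ℝ ↦ ∑ ρ ∈ weilZeroFinset T, (riemannZetaZeroOrder (ρ : ℂ) : ℂ) * g (ρ : ℂ).im)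
      atTop (𝓝 (∑' ρ : ZetaZeros.riemannZetaNontrivialZeros, (riemannZetaZeroOrder (ρ : ℂ) : ℂ) * g (ρ : ℂ).im)) :=
    hA.hasSum.comp tendsto_weilZeroFinset
  have h2 : Tendsto (fun T : ℝ ↦ ∑ n ∈ Finset.range (zetaZeroCount T), (g (zetaOrdinate n) + g (-zetaOrdinate n)))
      atTop (𝓝 (∑' n : ℕ, (g (zetaOrdinate n) + g (-zetaOrdinate n)))) :=
    hB.hasSum.tendsto_sum_nat.comp tendsto_zetaZeroCount_atTop_holds
  have h3 : (fun T : ℝ ↦ ∑ ρ ∈ weilZeroFinset T, (riemannZetaZeroOrder (ρ : ℂ) : ℂ) * g (ρ : ℂ).im) =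
      fun T : ℝ ↦ ∑ n ∈ Finset.range (zetaZeroCount T), (g (zetaOrdinate n) + g (-zetaOrdinate n)) :=
    funext fun T ↦ OrdinateDictionary.sum_weilZeroFinset_mul_eq_sum_range g T
  rw [h3] at h1
  exact tendsto_nhds_unique h1 h2

/-! ## Application: Montgomery's sum over zeros -/

/-- Comparison of Cauchy kernels: `1/(1 + (t - γ)²) ≤ 2(1 + t²)/(1 + γ²)`. [folklore] -/
theorem OrdinateDictionary.one_div_one_add_sq_sub_le (t γ : ℝ) :
    1 / (1 + (t - γ) ^ 2) ≤ 2 * (1 + t ^ 2) / (1 + γ ^ 2) := by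
  rw [div_le_div_iff₀ (by positivity) (by positivity)]
  nlinarith [sq_nonneg (t - γ + t), sq_nonneg (t - γ), sq_nonneg t, sq_nonneg γ,
    mul_nonneg (sq_nonneg (t - γ)) (sq_nonneg t)]

/-- The family `ρ ↦ m(ρ) x^{i Im ρ}/(1 + (t − Im ρ)²)` is summable over the non-trivial zeros
(`x > 0`; by `∑_ρ m(ρ)/(1 + (Im ρ)²) < ∞`, `ZetaZeroSum.summable_zeroOrder_div_one_add_sq`). [folklore] -/
theorem summable_zeroOrder_mul_cpow_div {x : ℝ} (hx : 0 < x) (t : ℝ) :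
    Summable fun ρ : ZetaZeros.riemannZetaNontrivialZeros ↦
      (riemannZetaZeroOrder (ρ : ℂ) : ℂ) *
        ((x : ℂ) ^ ((((ρ : ℂ).im : ℝ) : ℂ) * I) / ((1 + (t - (ρ : ℂ).im) ^ 2 : ℝ) : ℂ)) := by
  refine .of_norm_bounded (ZetaZeroSum.summable_zeroOrder_div_one_add_sq.mul_left (2 * (1 + t ^ 2)))
    fun ρ ↦ ?_
  have hm : (0 : ℝ) ≤ riemannZetaZeroOrder (ρ : ℂ) := ZetaZeroSum.zeroOrder_nonneg ρ
  have hunit : ‖(x : ℂ) ^ ((((ρ : ℂ).im : ℝ) : ℂ) * I)‖ = 1 := by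
    rw [Complex.norm_cpow_eq_rpow_re_of_pos hx]; simp
  rw [norm_mul, Complex.norm_intCast, abs_of_nonneg hm, norm_div, hunit, Complex.norm_real,
    Real.norm_of_nonneg (by positivity)]
  calc (riemannZetaZeroOrder (ρ : ℂ) : ℝ) * (1 / (1 + (t - (ρ : ℂ).im) ^ 2))
      ≤ (riemannZetaZeroOrder (ρ : ℂ) : ℝ) * (2 * (1 + t ^ 2) / (1 + (ρ : ℂ).im ^ 2)) :=
        mul_le_mul_of_nonneg_left (OrdinateDictionary.one_div_one_add_sq_sub_le t _) hm
    _ = 2 * (1 + t ^ 2) * ((riemannZetaZeroOrder (ρ : ℂ) : ℝ) / (1 + (ρ : ℂ).im ^ 2)) := by ring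

/-- **Montgomery's sum over zeros as a sum over the zero set**: for `x > 0` and real `t`,
`∑_{ρ non-trivial} m(ρ) x^{i Im ρ}/(1 + (t − Im ρ)²) = S(x, t) = montgomeryZeroSum x t`
(`= ∑_n [x^{iγ_n}/(1+(t−γ_n)²) + x^{−iγ_n}/(1+(t+γ_n)²)]`, `MontgomeryPairCorrelation.lean`).
Unconditional; under RH `ρ = 1/2 + i Im ρ`, so this is the sum `∑_γ x^{iγ}/(1+(t−γ)²)` of
Montgomery's explicit formula (Montgomery 1973, Lemma; Goldston 2005, (3.11)) written over the zeros. [folklore] -/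
theorem tsum_zeroOrder_mul_cpow_div_eq_montgomeryZeroSum {x : ℝ} (hx : 0 < x) (t : ℝ) :
    ∑' ρ : ZetaZeros.riemannZetaNontrivialZeros,
      (riemannZetaZeroOrder (ρ : ℂ) : ℂ) *
        ((x : ℂ) ^ ((((ρ : ℂ).im : ℝ) : ℂ) * I) / ((1 + (t - (ρ : ℂ).im) ^ 2 : ℝ) : ℂ)) =
      montgomeryZeroSum x t := by
  set g : ℝ → ℂ := fun γ ↦ (x : ℂ) ^ ((γ : ℂ) * I) / ((1 + (t - γ) ^ 2 : ℝ) : ℂ) with hg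
  have hsummand : ∀ n : ℕ, g (zetaOrdinate n) + g (-zetaOrdinate n) = montgomeryZeroSummand x t n := by
    intro n
    simp only [hg, montgomeryZeroSummand]
    congr 2
    · push_cast; ring
    · push_cast; ring
  have hB : Summable fun n : ℕ ↦ g (zetaOrdinate n) + g (-zetaOrdinate n) := by
    simp_rw [hsummand]; exact Montgomery.summable_montgomeryZeroSummand hx t
  have h := tsum_nontrivialZeros_eq_tsum_zetaOrdinate g (summable_zeroOrder_mul_cpow_div hx t) hB
  simp only [hg] at h
  rw [h, montgomeryZeroSum]
  exact tsum_congr fun n ↦ hsummand n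

end Literature.NumberTheory.LFunctions
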